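import Literature.Probability.Percolation.FourFunctionsProdBernoulli
import Literature.Probability.Percolation.TwoPairClusterSplit
import Literature.Probability.LatticeModels.ProdBernoulliWeightContinuity
import HarnessLib

/-!
# `NoHeavyLowerTail` (stmt-CriticalPhenomena-4575), four-point law: the rank-one cut-vertex minors of
# types I and II are theorems — `[abc|d]·[cd|a|b] ≤ [abcd]·[a|b|c|d]` (Ahlswede–Daykin) and
# `[abc|d]·[ab|cd] ≤ [abcd]·[ab|c|d]` (AD × the two-pair split)

Support file (prover seat `prim-l12-p2`, gen 4; `--supports stmt-CriticalPhenomena-4575`).  Proofs only: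
no definitions, no named facts, standard axioms.

Setting: bond percolation with arbitrary edge probabilities `w : Sym2 V → [0,1]` on a finite vertex type
(`μ = prodBernoulli w` on `BondConfig V = Set (Sym2 V)`), four vertices `a, b, c, d`; `[π]` denotes the
probability that the open clusters induce the partition `π` of `{a, b, c, d}` (written below as explicit
intersections of the connection events `openConn u v = {u ↔ v}` and their complements).

Background.  On the cut-vertex face `CUT:b:{a,y}|c` of the four-point law (the laws of graphs in which
`b` separates `{a, y}` from `c`) the `15`-cell law is a rank-one `5 × 2` matrix, so its `2 × 2` minors
vanish there; prim-l12-p2 gen 3 (memo FINDING-g3-HQT-STEP-HIDDEN-VERTEX.md) observed that 26 of these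
minors have a CONSTANT SIGN on all realizable laws, and ttrl cp-cst (MINORS26.md, 2026-08-20) confirmed
it with 0 violations on 7.2·10⁹ exact row instances (all graphs on ≤ 7 vertices, all placements, 18
weightings; all connected graphs on 8 vertices).  Up to relabelling the 26 rows are five inequalities:

* (I)   `[abc|d] · [ab|cd]  ≤ [abcd] · [ab|c|d]`
* (II)  `[abc|d] · [cd|a|b] ≤ [abcd] · [a|b|c|d]`
* (III) `[ab|c|d] · [ad|bc] ≤ [abc|d] · [ad|b|c]`
* (IV)  `[ab|c|d] · [a|bc|d] ≤ [abc|d] · [a|b|c|d]`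
* (V)   `[ab|cd] · [a|b|c|d] ≤ [ab|c|d] · [a|b|cd]`   (SPLIT = `twoPairSplit`, van den Berg–Häggström–Kahn 2006 Thm 2.1)

THIS FILE proves (II) and (I) for every finite weighted graph:

* `minorII` — (II) is the four-events form of the Ahlswede–Daykin four functions theorem for the product
  measure (`prodBernoulli_fourEvents`): a configuration of the cell `abc|d` and one of the cell `cd|a|b`
  INTERSECT in a configuration of `a|b|c|d` (every pair is separated in one of the two) and UNITE in a
  configuration of `abcd` (the cells are complementary in the partition lattice: meet `0̂`, join `1̂`) —
  the same mechanism as `crossingSplits`.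
* `minorI` — (I) follows from (II) and (V): `[a|b|c|d]·([abc|d][ab|cd]) ≤ [a|b|c|d]·([abcd][ab|c|d])`
  (`minorI_mul`), the factor `[a|b|c|d]` is cancelled for non-degenerate weights and the general case
  follows by the closure principle `weights_le_of_forall_prodBernoulli_real_pos` (continuity in the
  weights); the coincidence `a = b` (where `[a|b|c|d] ≡ 0`) is again a direct Ahlswede–Daykin instance,
  the other coincidences are `0 ≤ RHS`.

(III) and (IV) are single instances of the two-SET exchange inequality `setTwoClusterExchange`
(BHK 2006 Thm 2.1 with `S = {d}`): companion file `…LowerTailCutVertexMinorsBHK`.  None of (I)–(IV) is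
in the cone of Harris rows (prim-l12-p2 gen 4, kit j091085/j091246: exact LP separations), which is why
they were invisible to the quadratic dictionaries of the `H_{q+t}` programme.
[cite: BollobasRiordan2006, Ch. 2 Thm. 7 and eq. (14)]; [cite: VandenbergHaggstromKahn2005, Thm. 2.1 (p. 9)]
-/

noncomputable section

open MeasureTheory Set
open Literature.Probability.LatticeModels
open Literature.Probability.Percolation

namespace Summit.CriticalPhenomena.PercolationContinuityZ3.Theorems.CutVertexMinors

variable {V : Type*}

/-- Membership in a connection event is reachability in the open graph. [folklore] -/
private theorem mem_openConn {ω : BondConfig V} {u v : V} :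
    ω ∈ (openConn u v : Set (BondConfig V)) ↔ (openGraph ω).Reachable u v := Iff.rfl

/-- `{u ↮ u} = ∅`. [folklore] -/
private theorem compl_openConn_self (u : V) : (openConn u u : Set (BondConfig V))ᶜ = ∅ :=
  Set.eq_empty_iff_forall_notMem.2 fun _ h => h (SimpleGraph.Reachable.refl u)

/-- **Minor of type II (Ahlswede–Daykin).**  For every finite weighted graph and vertices `a, b, c, d`:
`[abc|d] · [cd|a|b] ≤ [a|b|c|d] · [abcd]`, i.e.
`μ({a↔b}∩{b↔c}∩{a↮d}∩{b↮d}∩{c↮d}) · μ({a↮c}∩{a↮d}∩{b↮c}∩{b↮d}∩({a↮b}∩{c↔d}))`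
`≤ μ({a↮c}∩{a↮d}∩{b↮c}∩{b↮d}∩({a↮b}∩{c↮d})) · μ({a↔b}∩{b↔c}∩{c↔d})`.
Four-events form of the four functions theorem: the two cells on the left meet in the discrete
partition and join in the connected one.
[cite: BollobasRiordan2006, Ch. 2 Thm. 7 and eq. (14) — corollary, derived in this file] -/
theorem minorII [Fintype V] (w : Sym2 V → unitInterval) (a b c d : V) :
    (prodBernoulli w).real
        (openConn a b ∩ openConn b c ∩ (openConn a d)ᶜ ∩ (openConn b d)ᶜ ∩ (openConn c d)ᶜ) *
      (prodBernoulli w).real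
        ((openConn a c)ᶜ ∩ (openConn a d)ᶜ ∩ (openConn b c)ᶜ ∩ (openConn b d)ᶜ ∩
          ((openConn a b)ᶜ ∩ openConn c d)) ≤
    (prodBernoulli w).real
        ((openConn a c)ᶜ ∩ (openConn a d)ᶜ ∩ (openConn b c)ᶜ ∩ (openConn b d)ᶜ ∩
          ((openConn a b)ᶜ ∩ (openConn c d)ᶜ)) *
      (prodBernoulli w).real (openConn a b ∩ openConn b c ∩ openConn c d) := by
  refine prodBernoulli_fourEvents w _ _ _ _ fun ω hω ω' hω' => ?_
  simp only [mem_inter_iff, mem_compl_iff, mem_openConn] at hω hω' ⊢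
  obtain ⟨⟨⟨⟨hab, hbc⟩, had⟩, hbd⟩, hcd⟩ := hω
  obtain ⟨⟨⟨⟨hac', had'⟩, hbc'⟩, hbd'⟩, hab', hcd'⟩ := hω'
  have hl : openGraph (ω ∩ ω') ≤ openGraph ω := BHK2006.openGraph_le inter_subset_left
  have hl' : openGraph (ω ∩ ω') ≤ openGraph ω' := BHK2006.openGraph_le inter_subset_right
  have hu : openGraph ω ≤ openGraph (ω ∪ ω') := BHK2006.openGraph_le subset_union_left
  have hu' : openGraph ω' ≤ openGraph (ω ∪ ω') := BHK2006.openGraph_le subset_union_right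
  exact ⟨⟨⟨⟨⟨fun h => hac' (h.mono hl'), fun h => had' (h.mono hl')⟩, fun h => hbc' (h.mono hl')⟩,
    fun h => hbd' (h.mono hl')⟩, fun h => hab' (h.mono hl'), fun h => hcd (h.mono hl)⟩,
    ⟨hab.mono hu, hbc.mono hu⟩, hcd'.mono hu'⟩

/-- **The product form of the type-I minor**: `[a|b|c|d] · ([abc|d]·[ab|cd]) ≤ [a|b|c|d] · ([abcd]·[ab|c|d])`,
from `minorII` (`[abc|d][cd|a|b] ≤ [a|b|c|d][abcd]`) and the two-pair split
`[ab|cd][a|b|c|d] ≤ [ab|c|d][a|b|cd]` (`twoPairSplit`, BHK 2006 Thm 2.1). [this work] -/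
theorem minorI_mul [Fintype V] (w : Sym2 V → unitInterval) (a b c d : V) :
    (prodBernoulli w).real
        ((openConn a c)ᶜ ∩ (openConn a d)ᶜ ∩ (openConn b c)ᶜ ∩ (openConn b d)ᶜ ∩
          ((openConn a b)ᶜ ∩ (openConn c d)ᶜ)) *
      ((prodBernoulli w).real
          (openConn a b ∩ openConn b c ∩ (openConn a d)ᶜ ∩ (openConn b d)ᶜ ∩ (openConn c d)ᶜ) *
        (prodBernoulli w).real
          ((openConn a c)ᶜ ∩ (openConn a d)ᶜ ∩ (openConn b c)ᶜ ∩ (openConn b d)ᶜ ∩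
            (openConn a b ∩ openConn c d))) ≤
    (prodBernoulli w).real
        ((openConn a c)ᶜ ∩ (openConn a d)ᶜ ∩ (openConn b c)ᶜ ∩ (openConn b d)ᶜ ∩
          ((openConn a b)ᶜ ∩ (openConn c d)ᶜ)) *
      ((prodBernoulli w).real (openConn a b ∩ openConn b c ∩ openConn c d) *
        (prodBernoulli w).real
          ((openConn a c)ᶜ ∩ (openConn a d)ᶜ ∩ (openConn b c)ᶜ ∩ (openConn b d)ᶜ ∩
            (openConn a b ∩ (openConn c d)ᶜ))) := by
  have h2 := minorII w a b c d
  have hs := twoPairSplit w a b c d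
  set μ := prodBernoulli w
  set Q := μ.real ((openConn a c)ᶜ ∩ (openConn a d)ᶜ ∩ (openConn b c)ᶜ ∩ (openConn b d)ᶜ ∩
    ((openConn a b)ᶜ ∩ (openConn c d)ᶜ))
  set T := μ.real (openConn a b ∩ openConn b c ∩ (openConn a d)ᶜ ∩ (openConn b d)ᶜ ∩ (openConn c d)ᶜ)
  set R := μ.real ((openConn a c)ᶜ ∩ (openConn a d)ᶜ ∩ (openConn b c)ᶜ ∩ (openConn b d)ᶜ ∩
    (openConn a b ∩ openConn c d))
  set A := μ.real (openConn a b ∩ openConn b c ∩ openConn c d)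
  set U := μ.real ((openConn a c)ᶜ ∩ (openConn a d)ᶜ ∩ (openConn b c)ᶜ ∩ (openConn b d)ᶜ ∩
    (openConn a b ∩ (openConn c d)ᶜ))
  set P := μ.real ((openConn a c)ᶜ ∩ (openConn a d)ᶜ ∩ (openConn b c)ᶜ ∩ (openConn b d)ᶜ ∩
    ((openConn a b)ᶜ ∩ openConn c d))
  have hT : 0 ≤ T := measureReal_nonneg
  have hU : 0 ≤ U := measureReal_nonneg
  calc Q * (T * R) = T * (R * Q) := by ring
    _ ≤ T * (U * P) := mul_le_mul_of_nonneg_left hs hT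
    _ = U * (T * P) := by ring
    _ ≤ U * (Q * A) := mul_le_mul_of_nonneg_left h2 hU
    _ = Q * (A * U) := by ring

/-- **Minor of type I.**  For every finite weighted graph and vertices `a, b, c, d`:
`[abc|d] · [ab|cd] ≤ [abcd] · [ab|c|d]`, i.e.
`μ({a↔b}∩{b↔c}∩{a↮d}∩{b↮d}∩{c↮d}) · μ({a↮c}∩{a↮d}∩{b↮c}∩{b↮d}∩({a↔b}∩{c↔d}))`
`≤ μ({a↔b}∩{b↔c}∩{c↔d}) · μ({a↮c}∩{a↮d}∩{b↮c}∩{b↮d}∩({a↔b}∩{c↮d}))`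
("given that the cluster of `a, b` is larger — it contains `c` — `d` is more likely to join it").
Proof: `minorI_mul`, cancellation of `[a|b|c|d] > 0` for non-degenerate weights, closure principle in the
weights; the coincidence `a = b` is a direct Ahlswede–Daykin instance, the other coincidences make the
left-hand side vanish. [this work] -/
theorem minorI [Fintype V] (w : Sym2 V → unitInterval) (a b c d : V) :
    (prodBernoulli w).real
        (openConn a b ∩ openConn b c ∩ (openConn a d)ᶜ ∩ (openConn b d)ᶜ ∩ (openConn c d)ᶜ) *
      (prodBernoulli w).real
        ((openConn a c)ᶜ ∩ (openConn a d)ᶜ ∩ (openConn b c)ᶜ ∩ (openConn b d)ᶜ ∩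
          (openConn a b ∩ openConn c d)) ≤
    (prodBernoulli w).real (openConn a b ∩ openConn b c ∩ openConn c d) *
      (prodBernoulli w).real
        ((openConn a c)ᶜ ∩ (openConn a d)ᶜ ∩ (openConn b c)ᶜ ∩ (openConn b d)ᶜ ∩
          (openConn a b ∩ (openConn c d)ᶜ)) := by
  classical
  by_cases hab : a = b
  · -- `a = b`: `[ac|d]·[cd|a] ≤ [acd]·[a|c|d]`, Ahlswede–Daykin directly (meet discrete, join connected)
    subst hab
    have key := prodBernoulli_fourEvents w
      (openConn a a ∩ openConn a c ∩ (openConn a d)ᶜ ∩ (openConn a d)ᶜ ∩ (openConn c d)ᶜ)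
      ((openConn a c)ᶜ ∩ (openConn a d)ᶜ ∩ (openConn a c)ᶜ ∩ (openConn a d)ᶜ ∩
        (openConn a a ∩ openConn c d))
      ((openConn a c)ᶜ ∩ (openConn a d)ᶜ ∩ (openConn a c)ᶜ ∩ (openConn a d)ᶜ ∩
        (openConn a a ∩ (openConn c d)ᶜ))
      (openConn a a ∩ openConn a c ∩ openConn c d) fun ω hω ω' hω' => by
        simp only [mem_inter_iff, mem_compl_iff, mem_openConn] at hω hω' ⊢
        obtain ⟨⟨⟨⟨-, hac⟩, had⟩, -⟩, hcd⟩ := hω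
        obtain ⟨⟨⟨⟨hac', had'⟩, -⟩, -⟩, -, hcd'⟩ := hω'
        have hl : openGraph (ω ∩ ω') ≤ openGraph ω := BHK2006.openGraph_le inter_subset_left
        have hl' : openGraph (ω ∩ ω') ≤ openGraph ω' := BHK2006.openGraph_le inter_subset_right
        have hu : openGraph ω ≤ openGraph (ω ∪ ω') := BHK2006.openGraph_le subset_union_left
        have hu' : openGraph ω' ≤ openGraph (ω ∪ ω') := BHK2006.openGraph_le subset_union_right
        exact ⟨⟨⟨⟨⟨fun h => hac' (h.mono hl'), fun h => had' (h.mono hl')⟩, fun h => hac' (h.mono hl')⟩,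
          fun h => had' (h.mono hl')⟩, SimpleGraph.Reachable.refl a, fun h => hcd (h.mono hl)⟩,
          ⟨SimpleGraph.Reachable.refl a, hac.mono hu⟩, hcd'.mono hu'⟩
    simpa only [mul_comm] using key
  -- the other coincidences kill a factor on the left-hand side
  by_cases hac : a = c
  · subst hac
    simp only [compl_openConn_self, empty_inter, measureReal_empty, mul_zero]
    exact le_rfl
  by_cases had : a = d
  · subst had
    simp only [compl_openConn_self, empty_inter, inter_empty, measureReal_empty, mul_zero]
    exact le_rfl
  by_cases hbc : b = c
  · subst hbc
    simp only [compl_openConn_self, empty_inter, inter_empty, measureReal_empty, mul_zero]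
    exact le_rfl
  by_cases hbd : b = d
  · subst hbd
    simp only [compl_openConn_self, empty_inter, inter_empty, measureReal_empty, mul_zero]
    exact le_rfl
  by_cases hcd : c = d
  · subst hcd
    simp only [compl_openConn_self, inter_empty, measureReal_empty, mul_zero, zero_mul]
    exact le_rfl
  -- all four vertices distinct: the discrete cell is a nonempty event, so it has positive probability for
  -- non-degenerate weights, and `minorI_mul` can be cancelled; closure principle for general weights.
  have hQne : ((openConn a c)ᶜ ∩ (openConn a d)ᶜ ∩ (openConn b c)ᶜ ∩ (openConn b d)ᶜ ∩
      ((openConn a b)ᶜ ∩ (openConn c d)ᶜ) : Set (BondConfig V)).Nonempty := by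
    refine ⟨∅, ?_⟩
    have hbot : openGraph (∅ : BondConfig V) = ⊥ := SimpleGraph.fromEdgeSet_empty
    simp only [mem_inter_iff, mem_compl_iff, mem_openConn, hbot, SimpleGraph.reachable_bot]
    exact ⟨⟨⟨⟨hac, had⟩, hbc⟩, hbd⟩, hab, hcd⟩
  refine weights_le_of_forall_prodBernoulli_real_pos
    (f := fun p : Sym2 V → unitInterval =>
      (prodBernoulli p).real
          (openConn a b ∩ openConn b c ∩ (openConn a d)ᶜ ∩ (openConn b d)ᶜ ∩ (openConn c d)ᶜ) *
        (prodBernoulli p).real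
          ((openConn a c)ᶜ ∩ (openConn a d)ᶜ ∩ (openConn b c)ᶜ ∩ (openConn b d)ᶜ ∩
            (openConn a b ∩ openConn c d)))
    (g := fun p : Sym2 V → unitInterval =>
      (prodBernoulli p).real (openConn a b ∩ openConn b c ∩ openConn c d) *
        (prodBernoulli p).real
          ((openConn a c)ᶜ ∩ (openConn a d)ᶜ ∩ (openConn b c)ᶜ ∩ (openConn b d)ᶜ ∩
            (openConn a b ∩ (openConn c d)ᶜ)))
    ((prodBernoulli_real_continuous _).mul (prodBernoulli_real_continuous _))
    ((prodBernoulli_real_continuous _).mul (prodBernoulli_real_continuous _)) (fun p hpos => ?_) w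
  exact le_of_mul_le_mul_left (minorI_mul p a b c d) (hpos _ hQne)

end Summit.CriticalPhenomena.PercolationContinuityZ3.Theorems.CutVertexMinors
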